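/-
COR-CM (cell pub-hodgecm2, stage 2 of the Hodge ladder) — count-neutral KERNEL COMBINATORICS «the split index-two cyclic census at ODD level: μ = φ₂ = β − 2
via the complement ⟨u², w⟩» (seat prover-pub-hodgecm2-b23-g50-0, binder prover b23, gen 50; own census lane INDEX-TWO CYCLIC 2-GROUPS, extension «SMALL
DEGREES», claim HOME/INBOX.md l.23042, INTERIM #1 l.23124).  Theorems only; seat b23 gen 49ʼs `Census/IndexTwoCyclicLaw.lean` (`⟨u², w⟩` has index two,
`uⁱ ∉ ⟨u², w⟩` for odd `i`), gen 49 X (`exists_datum_of_involution`) and gen 40ʼs complement law `Census/ComplementFacesGenerate.lean` are used BY NAME.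
No definition, no `decide`, no certificate, no named fact, no `sorry`.  `Interfaces.lean` (C1), every E term, B01, `Transposition/*`, `PortJoin/*`,
`D2Bridge/*` untouched.
HONEST FRAMING: `HC_CM` is NOT proved, here or anywhere in the tree; nothing here is a period, a count of record or a headline.
T5: n/a-class (hypothesis binders: the index-two cyclic datum (inhabited: `Census/IndexTwoCyclicInstance.lean`), `Odd n`, `c·c = 1`, `c ≠ 1`; checker:
self, 2026-08-25).
-/
import Summits.HodgeConjecture.CorCM.Census.IndexTwoCyclicSquareTwist
import Summits.HodgeConjecture.CorCM.Census.ComplementFacesGenerate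
import HarnessLib

/-!
# The split index-two cyclic census at odd level

Let `D : IndexTwoCyclic.Datum G c n` (`Census/IndexTwoCyclicDatum.lean`: `u` of order `2n` with `uⁿ = c`, `[G : ⟨u⟩] = 2`, an involution `w ∉ ⟨u⟩`,
`w u = uʳ w`).  Seat b23 gen 49ʼs INDEX-TWO CYCLIC LAW needs `n` EVEN (`c ∈ ⟨u^{r+1}⟩`).  At ODD level the census closes for a different reason:
**`c = uⁿ` with `n` odd lies OUTSIDE the index-two subgroup `⟨u², w⟩`** (gen 49, `Census/IndexTwoCyclicLaw.lean`: `pow_notMem_closure_of_odd`,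
`index_closure_eq_two`), i.e. `⟨u², w⟩` is a COMPLEMENT of `c` (`G = ⟨u², w⟩ × ⟨c⟩`; the Galois CM field contains an imaginary quadratic field), and
seat b23 gen 40ʼs complement law (`Census/ComplementFacesGenerate.lean`) gives `μ = φ₂` — here `= β − 2` since `|G|/2 = 2n` is even.

* §1 `c_notMem_closure_of_odd`, `cpl_closure_of_odd`; **`isLeast_card_gfaces_generate_fibreTwo_of_odd (D) (hc2) (hc1) (hn : Odd n)`** (`μ = φ₂`),
  `card_block_eq_fibreTwo_add_two_of_odd` (`β = φ₂ + 2`), `isLeast_card_gfaces_generate_of_odd` (`μ = β − 2`).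
* §2 structure-free: **`isLeast_card_gfaces_generate_fibreTwo_of_involution_odd (u w) (hn) (hun) (hord) (hindex) (hw) (hww)`**.
Together with gen 49ʼs 2-power capstone every split index-two cyclic datum whose level is odd OR a power of two is settled; the open split cases are the
mixed levels `n = 2ᵃ·m`, `a ≥ 1`, `m > 1` odd, with `c ∉ ⟨u^{r+1}⟩` and `r ≢ −1` (e.g. `D(ℤ/8) × ℤ/3`), where only `β − 2 ≤ μ ≤ β − 1` is known
(`Census/IndexTwoCyclicDichotomy.lean`).

## References
* [Pohlmann1968] H. Pohlmann, Algebraic cycles on abelian varieties of complex multiplication type, Ann. of Math. 88 (1968), Thm 1.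
-/

namespace Summit.HodgeConjecture.CorCM.Census.IndexTwoCyclic

open Finset
open Summit.HodgeConjecture.CorCM.Prior.AllgGroup.RfwfAllgGroup
open Summit.HodgeConjecture.CorCM.Census.BlockParity
open Summit.HodgeConjecture.CorCM.Census.Coinvariant

noncomputable section

variable {G : Type*} [Group G] [Fintype G] [DecidableEq G] {c : G} {n : ℕ} [NeZero n]
variable (D : Datum G c n) (hc2 : c * c = 1) (hc1 : c ≠ 1)

/-! ## §1 At odd level `⟨u², w⟩` is a complement of `c` -/

omit [Fintype G] [DecidableEq G] in
/-- **At odd level `c = uⁿ ∉ ⟨u², w⟩`.** [folklore] -/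
theorem c_notMem_closure_of_odd (hn : Odd n) : c ∉ Subgroup.closure ({D.u ^ 2, D.w} : Set G) := by
  have h := pow_notMem_closure_of_odd D hn
  rwa [D.hun] at h

omit [DecidableEq G] in
/-- **At odd level `⟨u², w⟩` is a complement of `c`**: `x ∈ ⟨u², w⟩ ↔ c·x ∉ ⟨u², w⟩`. [folklore] -/
theorem cpl_closure_of_odd (hn : Odd n) (x : G) :
    x ∈ Subgroup.closure ({D.u ^ 2, D.w} : Set G) ↔ c * x ∉ Subgroup.closure ({D.u ^ 2, D.w} : Set G) :=
  cpl_of_index_two c (index_closure_eq_two D) (c_notMem_closure_of_odd D hn) x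

omit [DecidableEq G] in
include D in
/-- `c` is central along the datum (file-local restatement through `comm_pow_n`). [folklore] -/
private theorem c_central (y : G) : y * c = c * y := by
  have h := D.comm_pow_n y
  rwa [D.hun] at h

include D hc1 in
/-- **THE SPLIT INDEX-TWO CYCLIC CENSUS AT ODD LEVEL: `μ(G, c) = φ₂(G, c)`** — gen 40ʼs complement law along `⟨u², w⟩`. [folklore] -/
theorem isLeast_card_gfaces_generate_fibreTwo_of_odd (hn : Odd n) :
    IsLeast {m : ℕ | ∃ S : Finset (CMF G c →₀ ℤ), ↑S ⊆ gfaceSet G c hc2 ∧ S.card = m ∧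
      hodgeSpan c hc2 ≤ Submodule.span ℤ (pairSet c) ⊔ Submodule.span ℤ (translates c S)} (fibreTwo c hc2) :=
  ComplementFaces.isLeast_card_gfaces_generate_fibreTwo_of_cpl c (cpl_closure_of_odd D hn) hc2 hc1 (c_central D)

omit [DecidableEq G] [NeZero n] in
include D in
/-- `|G| / 2 = 2n` is even along the datum. [folklore] -/
private theorem even_card_div_two : Even (Fintype.card G / 2) := by
  have h := (Subgroup.zpowers D.u).card_mul_index
  rw [D.hindex, Nat.card_zpowers, D.hord, Nat.card_eq_fintype_card] at h
  exact ⟨n, by omega⟩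

include D hc1 in
/-- **`β = φ₂ + 2` at odd level.** [folklore] -/
theorem card_block_eq_fibreTwo_add_two_of_odd (hn : Odd n) : Fintype.card (Block c) = fibreTwo c hc2 + 2 :=
  (fibreTwo_add_two_eq_card_block_of_cpl c hc2 hc1 (c_central D) (cpl_closure_of_odd D hn) (even_card_div_two D)).symm

include D hc1 in
/-- **Block currency: `μ(G, c) = β(G, c) − 2`** for every split index-two cyclic datum of odd level. [folklore] -/
theorem isLeast_card_gfaces_generate_of_odd (hn : Odd n) :
    IsLeast {m : ℕ | ∃ S : Finset (CMF G c →₀ ℤ), ↑S ⊆ gfaceSet G c hc2 ∧ S.card = m ∧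
      hodgeSpan c hc2 ≤ Submodule.span ℤ (pairSet c) ⊔ Submodule.span ℤ (translates c S)} (Fintype.card (Block c) - 2) := by
  rw [card_block_eq_fibreTwo_add_two_of_odd D hc2 hc1 hn, Nat.add_sub_cancel]
  exact isLeast_card_gfaces_generate_fibreTwo_of_odd D hc2 hc1 hn

/-! ## §2 Structure-free form -/

omit [NeZero n] in
include hc1 in
/-- **STRUCTURE-FREE FORM**: `u` of order `2n` (`n` odd) generating a subgroup of index two, `c = uⁿ`, an involution `w ∉ ⟨u⟩` — then
`μ(G, c) = φ₂(G, c)`, whatever the twist. [folklore] -/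
theorem isLeast_card_gfaces_generate_fibreTwo_of_involution_odd (u w : G) (hn : Odd n) (hun : u ^ n = c) (hord : orderOf u = 2 * n)
    (hindex : (Subgroup.zpowers u).index = 2) (hw : w ∉ Subgroup.zpowers u) (hww : w * w = 1) :
    IsLeast {m : ℕ | ∃ S : Finset (CMF G c →₀ ℤ), ↑S ⊆ gfaceSet G c hc2 ∧ S.card = m ∧
      hodgeSpan c hc2 ≤ Submodule.span ℤ (pairSet c) ⊔ Submodule.span ℤ (translates c S)} (fibreTwo c hc2) := by
  haveI : NeZero n := ⟨fun h => by rw [h] at hn; exact Nat.not_odd_zero hn⟩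
  obtain ⟨D, -, -⟩ := exists_datum_of_involution (c := c) u w hun hord hindex hw hww
  exact isLeast_card_gfaces_generate_fibreTwo_of_odd D hc2 hc1 hn

end

end Summit.HodgeConjecture.CorCM.Census.IndexTwoCyclic
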